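import Summits.BirchSwinnertonDyer.BirchSwinnertonDyer.Theorems.PlecticLegsArtinBaseChangeEulerLocal
import Mathlib.NumberTheory.LSeries.Dirichlet

/-!
# Artin formalism for `L(E/F, s)`, `F = ℚ(ζ_m)^H`, as an identity of Dirichlet series

Route `PlecticLegs`, support item `ArtinBaseChange` (stmt-BirchSwinnertonDyer-18261). Multiplying
the local Artin identity (`PlecticLegsArtinBaseChangeEulerLocal`) over the places `v ∤ m` of `ℚ` and
stripping the Euler factors above the places `v ∣ m` on both sides gives, for Mathlib's formal
Euler products,
`L(E_F) · P_F = ∏_{χ ∈ Y_H} (χ • L(E))` with `P_F = ∏_{w ∣ m} L_w(E_F, N w^{-s})`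
(`intCoe_LFunction_baseChange_mul_eq_prod_twist`), and `L(E) · P = 1_m • L(E)` with
`P = ∏_{v ∣ m} L_v(E, p^{-s})` (`intCoe_LFunction_mul_eq_twist_one`): `L^{(m)}(E/F, s) =
∏_χ L^{(m)}(E, χ, s)` for the `L`-series with the Euler factors at `m` removed.
-/

noncomputable section

-- D-0017: single-problem summit, so `Summit.BirchSwinnertonDyer.BirchSwinnertonDyer.…` repeats a
-- namespace BY DESIGN.
set_option linter.dupNamespace false

open scoped Classical
open Filter ArithmeticFunction NumberField IsDedekindDomain WeierstrassCurve Polynomial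
  IsCyclotomicExtension.Rat Literature.NumberTheory.EllipticCurves

namespace Summit.BirchSwinnertonDyer.BirchSwinnertonDyer.Theorems

/-! ## Two more Euler-product lemmas -/

section EulerLemmas

variable {ι κ R : Type*} [CommSemiring R]

/-- The fibre products of a family converging to `1` coefficientwise converge to `1`
coefficientwise (extracted from the tree's `eulerProduct_eq_eulerProduct_finprod_fiber`).
[folklore] -/
theorem eventually_finprod_fiber_apply_eq_one (f : ι → ArithmeticFunction R) (π : ι → κ)
    (hfib : ∀ k, {i | π i = k}.Finite)
    (hf : ∀ n, ∀ᶠ i in cofinite, f i n = (1 : ArithmeticFunction R) n) (n : ℕ) :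
    ∀ᶠ k in cofinite, (∏ᶠ i ∈ {i | π i = k}, f i) n = (1 : ArithmeticFunction R) n := by
  have hB := ArithmeticFunction.finite_setOf_exists_apply_ne_one f hf n
  rw [eventually_cofinite]
  refine (hB.image π).subset fun k hk ↦ ?_
  by_contra hk'
  apply hk
  rw [finprod_mem_eq_finite_toFinset_prod _ (hfib k)]
  refine ArithmeticFunction.finsetProd_apply_eq_one_apply_of_le _ _ (fun i hi j hj ↦ ?_) n le_rfl
  by_contra hij
  exact hk' ⟨i, ⟨j, hj, hij⟩, (hfib k).mem_toFinset.mp hi⟩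

/-- A family that is `1` off a finite set converges to `1` coefficientwise. [folklore] -/
theorem eventually_apply_eq_one_of_eq_one (s : Finset ι) (f : ι → ArithmeticFunction R)
    (hf : ∀ i ∉ s, f i = 1) (n : ℕ) : ∀ᶠ i in cofinite, f i n = (1 : ArithmeticFunction R) n := by
  refine Filter.eventually_of_mem s.finite_toSet.compl_mem_cofinite fun i hi ↦ ?_
  rw [hf i (fun h ↦ hi (Finset.mem_coe.mpr h))]

end EulerLemmas

/-! ## The global identities of formal Euler products -/

section Global

variable (W : WeierstrassCurve ℚ) [W.IsElliptic] (m : ℕ) [NeZero m]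

/-- The set of finite places of `ℚ` dividing `m` is finite. [folklore] -/
theorem finite_setOf_natCast_mem :
    {v : HeightOneSpectrum (𝓞 ℚ) | (m : 𝓞 ℚ) ∈ v.asIdeal}.Finite := by
  have h := Ideal.finite_factors (I := Ideal.span {(m : 𝓞 ℚ)})
    (by rw [Ne, Ideal.zero_eq_bot, Ideal.span_singleton_eq_bot]; exact_mod_cast NeZero.ne m)
  refine h.subset fun v hv ↦ ?_
  simp only [Set.mem_setOf_eq] at hv ⊢
  rwa [Ideal.dvd_span_singleton]

omit [W.IsElliptic] [NeZero m] in
/-- At a place `v ∣ m` every Dirichlet character mod `m` kills the local factor: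
`χ(N v) = 0`, so the `χ`-twist of `L_v(E, p^{-s})⁻¹` is `1`. [folklore] -/
theorem twist_localEulerFactor_eq_one_of_mem (χ : DirichletCharacter ℂ m)
    {v : HeightOneSpectrum (𝓞 ℚ)} (hv : (m : 𝓞 ℚ) ∈ v.asIdeal) :
    (toArithmeticFunction (fun k : ℕ ↦ χ (k : ZMod m))).pmul
      (((W.baseChange (v.adicCompletion ℚ)).localEulerFactor (v.adicCompletionIntegers ℚ) :
        ArithmeticFunction ℤ) : ArithmeticFunction ℂ) = 1 := by
  obtain ⟨hp, hpv⟩ := residueCard_rat v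
  set p := v.residueCard with hpdef
  haveI : Fact p.Prime := ⟨hp⟩
  haveI : v.asIdeal.IsMaximal := v.isMaximal
  haveI := liesOver_span_of_natCast_mem p v.asIdeal hpv
  -- `p ∣ m`, so `p` is not a unit mod `m` and `χ p = 0`
  have hpm : p ∣ m := by
    have h : (m : ℤ) ∈ v.asIdeal.under ℤ := by
      rw [Ideal.under_def, Ideal.mem_comap, map_natCast]
      exact hv
    rw [← Ideal.over_def v.asIdeal (Ideal.span {(p : ℤ)}), Ideal.mem_span_singleton] at h
    exact Int.natCast_dvd_natCast.mp h
  have hχ : χ (p : ZMod m) = 0 := by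
    refine χ.map_nonunit fun hu ↦ ?_
    rw [ZMod.isUnit_iff_coprime] at hu
    exact hp.one_lt.ne' (Nat.Coprime.eq_one_of_dvd hu hpm)
  rw [W.localEulerFactor_baseChange_adicCompletion v, intCoe_ofPowerSeries hp.one_lt,
    twist_ofPowerSeries χ hp.one_lt, hχ, PowerSeries.rescale_zero, RingHom.comp_apply,
    map_invOfUnit_one _ (by rw [Polynomial.constantCoeff_coe, W.coeff_zero_localPolynomialAt v]),
    PowerSeries.constantCoeff_invOfUnit, inv_one, Units.val_one, map_one, map_one]

/-- At any place the local Euler factor times the local polynomial (as Dirichlet series in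
`N v^{-s}`) is `1`. [folklore] -/
theorem localEulerFactor_mul_ofPowerSeries {L : Type*} [Field L] [NumberField L]
    (X : WeierstrassCurve L) (w : HeightOneSpectrum (𝓞 L)) :
    (X.baseChange (w.adicCompletion L)).localEulerFactor (w.adicCompletionIntegers L) *
      ofPowerSeries w.residueCard ((X.localPolynomialAt w : ℤ[X]) : PowerSeries ℤ) = 1 := by
  rw [X.localEulerFactor_baseChange_adicCompletion w, ← map_mul, mul_comm,
    PowerSeries.mul_invOfUnit _ 1 (by rw [Polynomial.constantCoeff_coe,
      X.coeff_zero_localPolynomialAt w, Units.val_one]), map_one]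

variable (K : Type) [Field K] [NumberField K] [IsCyclotomicExtension {m} ℚ K] [IsGalois ℚ K]
  [IsMulCommutative Gal(K/ℚ)] (H : Subgroup Gal(K/ℚ))

set_option maxHeartbeats 800000 in
/-- **Artin formalism for the formal Euler products, Euler factors at `m` removed.** For
`F = ℚ(ζ_m)^H` with character group `Y_H`, as formal Dirichlet series over `ℂ`:
`L(E_F) · ∏_{v ∣ m} ∏_{w ∣ v} L_w(E_F, N w^{-s}) = ∏_{χ ∈ Y_H} χ • L(E)`, where `χ • L(E)` is the
naive twist `∑ χ(n) aₙ(E) n^{-s}`: both sides are Euler products over the places `v` of `ℚ` whose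
factors are `1` at `v ∣ m` and agree at `v ∤ m` by the local Artin identity
(`intCoe_finprod_localEulerFactor_baseChange_fixedField`). [folklore] -/
theorem intCoe_LFunction_baseChange_mul_eq_prod_twist :
    (((W.baseChange ↥(IntermediateField.fixedField H)).LFunction : ArithmeticFunction ℤ) :
        ArithmeticFunction ℂ) *
      ∏ v ∈ (finite_setOf_natCast_mem m).toFinset,
        ((∏ᶠ w ∈ {w : HeightOneSpectrum (𝓞 ↥(IntermediateField.fixedField H)) | w.under (𝓞 ℚ) = v},
          ofPowerSeries w.residueCard
            (((W.baseChange ↥(IntermediateField.fixedField H)).localPolynomialAt w : ℤ[X]) :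
              PowerSeries ℤ) : ArithmeticFunction ℤ) : ArithmeticFunction ℂ) =
      ∏ χ ∈ Finset.univ.filter (fun χ : DirichletCharacter ℂ m ↦
          χ ∈ (subgroupGalEquivSubgroupChar m K ℂ H).ofDual),
        (toArithmeticFunction (fun k : ℕ ↦ χ (k : ZMod m))).pmul
          ((W.LFunction : ArithmeticFunction ℤ) : ArithmeticFunction ℂ) := by
  set F := IntermediateField.fixedField H with hFdef
  set S := (finite_setOf_natCast_mem m).toFinset with hSdef
  have hS : ∀ v : HeightOneSpectrum (𝓞 ℚ), v ∈ S ↔ (m : 𝓞 ℚ) ∈ v.asIdeal := fun v ↦ by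
    rw [hSdef, Set.Finite.mem_toFinset, Set.mem_setOf_eq]
  set Φ : HeightOneSpectrum (𝓞 ℚ) → ArithmeticFunction ℤ := fun v ↦
    (W.baseChange (v.adicCompletion ℚ)).localEulerFactor (v.adicCompletionIntegers ℚ) with hΦ
  set ΦF : HeightOneSpectrum (𝓞 ℚ) → ArithmeticFunction ℤ := fun v ↦
    ∏ᶠ w ∈ {w : HeightOneSpectrum (𝓞 ↥F) | w.under (𝓞 ℚ) = v},
      ((W.baseChange ↥F).baseChange (w.adicCompletion ↥F)).localEulerFactor
        (w.adicCompletionIntegers ↥F) with hΦF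
  set ΨF : HeightOneSpectrum (𝓞 ℚ) → ArithmeticFunction ℤ := fun v ↦
    ∏ᶠ w ∈ {w : HeightOneSpectrum (𝓞 ↥F) | w.under (𝓞 ℚ) = v},
      ofPowerSeries w.residueCard (((W.baseChange ↥F).localPolynomialAt w : ℤ[X]) : PowerSeries ℤ)
    with hΨF
  -- convergence
  have hΦc : ∀ n, ∀ᶠ v in cofinite, Φ v n = (1 : ArithmeticFunction ℤ) n :=
    W.eventually_cofinite_localEulerFactor_apply
  have hΦFc : ∀ n, ∀ᶠ v in cofinite, ΦF v n = (1 : ArithmeticFunction ℤ) n :=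
    eventually_finprod_fiber_apply_eq_one _ (fun w : HeightOneSpectrum (𝓞 ↥F) ↦ w.under (𝓞 ℚ))
      (fun v ↦ v.finite_setOf_under_eq_of_numberField)
      (W.baseChange ↥F).eventually_cofinite_localEulerFactor_apply
  have hΦc' : ∀ n, ∀ᶠ v in cofinite, (Φ v : ArithmeticFunction ℂ) n = (1 : ArithmeticFunction ℂ) n :=
    eventually_intCoe_apply_eq_one hΦc
  -- the left-hand side as one Euler product
  have hG : ∀ v ∉ S, (if v ∈ S then (ΨF v : ArithmeticFunction ℂ) else 1) = 1 :=
    fun v hv ↦ if_neg hv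
  have hPF : ∏ v ∈ S, (ΨF v : ArithmeticFunction ℂ) =
      eulerProduct fun v ↦ (if v ∈ S then (ΨF v : ArithmeticFunction ℂ) else 1) := by
    rw [eulerProduct_eq_finset_prod_of_eq_one S _ hG]
    exact Finset.prod_congr rfl fun v hv ↦ (if_pos hv).symm
  have hLHS : (((W.baseChange ↥F).LFunction : ArithmeticFunction ℤ) : ArithmeticFunction ℂ) *
      ∏ v ∈ S, (ΨF v : ArithmeticFunction ℂ) =
      eulerProduct fun v ↦ (ΦF v : ArithmeticFunction ℂ) *
        (if v ∈ S then (ΨF v : ArithmeticFunction ℂ) else 1) := by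
    rw [(W.baseChange ↥F).LFunction_eq_eulerProduct_finprod_under ℚ, intCoe_eulerProduct _ hΦFc, hPF,
      ← ArithmeticFunction.eulerProduct_mul_eq _ _ (eventually_intCoe_apply_eq_one hΦFc)
        (eventually_apply_eq_one_of_eq_one S _ hG)]
  -- the right-hand side as one Euler product
  have hRHS : ∏ χ ∈ Finset.univ.filter (fun χ : DirichletCharacter ℂ m ↦
      χ ∈ (subgroupGalEquivSubgroupChar m K ℂ H).ofDual),
        (toArithmeticFunction (fun k : ℕ ↦ χ (k : ZMod m))).pmul
          ((W.LFunction : ArithmeticFunction ℤ) : ArithmeticFunction ℂ) =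
      eulerProduct fun v ↦ ∏ χ ∈ Finset.univ.filter (fun χ : DirichletCharacter ℂ m ↦
        χ ∈ (subgroupGalEquivSubgroupChar m K ℂ H).ofDual),
          (toArithmeticFunction (fun k : ℕ ↦ χ (k : ZMod m))).pmul (Φ v : ArithmeticFunction ℂ) := by
    rw [eulerProduct_finset_prod _ _ (fun χ _ n ↦ by
      filter_upwards [hΦc' n] with v hv
      rw [twist_apply, hv, ← twist_apply χ 1 n, twist_one])]
    refine Finset.prod_congr rfl fun χ _ ↦ ?_
    rw [W.LFunction_eq_eulerProduct, intCoe_eulerProduct _ hΦc, twist_eulerProduct χ _ hΦc']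
  rw [hLHS, hRHS]
  congr 1
  funext v
  by_cases hv : v ∈ S
  · -- `v ∣ m`: both factors are `1`
    rw [if_pos hv, Finset.prod_eq_one fun χ _ ↦
      twist_localEulerFactor_eq_one_of_mem W m χ ((hS v).mp hv), ← intCoe_mul, hΦF, hΨF]
    simp only
    rw [← finprod_mem_mul_distrib v.finite_setOf_under_eq_of_numberField,
      finprod_mem_of_eqOn_one fun w _ ↦ localEulerFactor_mul_ofPowerSeries (W.baseChange ↥F) w,
      intCoe_one]
  · -- `v ∤ m`: the local Artin identity
    rw [if_neg hv, mul_one]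
    exact intCoe_finprod_localEulerFactor_baseChange_fixedField W m K H v ((hS v).not.mp hv)

omit [W.IsElliptic] in
/-- **The trivial character: `L(E) · ∏_{v ∣ m} L_v(E, p^{-s}) = 1_m • L(E)`** (the `L`-series of
`E` with the Euler factors at `m` removed is the twist by the trivial character mod `m`).
[folklore] -/
theorem intCoe_LFunction_mul_eq_twist_one :
    ((W.LFunction : ArithmeticFunction ℤ) : ArithmeticFunction ℂ) *
      ∏ v ∈ (finite_setOf_natCast_mem m).toFinset,
        ((ofPowerSeries v.residueCard ((W.localPolynomialAt v : ℤ[X]) : PowerSeries ℤ) :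
          ArithmeticFunction ℤ) : ArithmeticFunction ℂ) =
      (toArithmeticFunction (fun k : ℕ ↦ (1 : DirichletCharacter ℂ m) (k : ZMod m))).pmul
        ((W.LFunction : ArithmeticFunction ℤ) : ArithmeticFunction ℂ) := by
  set S := (finite_setOf_natCast_mem m).toFinset with hSdef
  have hS : ∀ v : HeightOneSpectrum (𝓞 ℚ), v ∈ S ↔ (m : 𝓞 ℚ) ∈ v.asIdeal := fun v ↦ by
    rw [hSdef, Set.Finite.mem_toFinset, Set.mem_setOf_eq]
  set Φ : HeightOneSpectrum (𝓞 ℚ) → ArithmeticFunction ℤ := fun v ↦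
    (W.baseChange (v.adicCompletion ℚ)).localEulerFactor (v.adicCompletionIntegers ℚ) with hΦ
  set Ψ : HeightOneSpectrum (𝓞 ℚ) → ArithmeticFunction ℤ := fun v ↦
    ofPowerSeries v.residueCard ((W.localPolynomialAt v : ℤ[X]) : PowerSeries ℤ) with hΨ
  have hΦc : ∀ n, ∀ᶠ v in cofinite, Φ v n = (1 : ArithmeticFunction ℤ) n :=
    W.eventually_cofinite_localEulerFactor_apply
  have hΦc' : ∀ n, ∀ᶠ v in cofinite, (Φ v : ArithmeticFunction ℂ) n = (1 : ArithmeticFunction ℂ) n :=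
    eventually_intCoe_apply_eq_one hΦc
  have hG : ∀ v ∉ S, (if v ∈ S then (Ψ v : ArithmeticFunction ℂ) else 1) = 1 :=
    fun v hv ↦ if_neg hv
  have hP : ∏ v ∈ S, (Ψ v : ArithmeticFunction ℂ) =
      eulerProduct fun v ↦ (if v ∈ S then (Ψ v : ArithmeticFunction ℂ) else 1) := by
    rw [eulerProduct_eq_finset_prod_of_eq_one S _ hG]
    exact Finset.prod_congr rfl fun v hv ↦ (if_pos hv).symm
  have hLHS : ((W.LFunction : ArithmeticFunction ℤ) : ArithmeticFunction ℂ) *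
      ∏ v ∈ S, (Ψ v : ArithmeticFunction ℂ) =
      eulerProduct fun v ↦ (Φ v : ArithmeticFunction ℂ) *
        (if v ∈ S then (Ψ v : ArithmeticFunction ℂ) else 1) := by
    rw [W.LFunction_eq_eulerProduct, intCoe_eulerProduct _ hΦc, hP,
      ← ArithmeticFunction.eulerProduct_mul_eq _ _ hΦc' (eventually_apply_eq_one_of_eq_one S _ hG)]
  rw [hLHS, W.LFunction_eq_eulerProduct, intCoe_eulerProduct _ hΦc, twist_eulerProduct _ _ hΦc']
  congr 1
  funext v
  by_cases hv : v ∈ S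
  · rw [if_pos hv, twist_localEulerFactor_eq_one_of_mem W m 1 ((hS v).mp hv), ← intCoe_mul, hΦ, hΨ]
    simp only
    rw [localEulerFactor_mul_ofPowerSeries W v, intCoe_one]
  · rw [if_neg hv, mul_one]
    obtain ⟨hp, hpv⟩ := residueCard_rat v
    have hpm : ¬ v.residueCard ∣ m := by
      rintro ⟨k, hk⟩
      apply (hS v).not.mp hv
      rw [hk, Nat.cast_mul]
      exact v.asIdeal.mul_mem_right _ hpv
    have hu : IsUnit (v.residueCard : ZMod m) :=
      (ZMod.isUnit_iff_coprime _ _).mpr (hp.coprime_iff_not_dvd.mpr hpm)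
    rw [hΦ]
    simp only
    rw [W.localEulerFactor_baseChange_adicCompletion v, intCoe_ofPowerSeries hp.one_lt,
      twist_ofPowerSeries _ hp.one_lt, MulChar.one_apply hu, PowerSeries.rescale_one, RingHom.id_apply]

end Global

end Summit.BirchSwinnertonDyer.BirchSwinnertonDyer.Theorems

end
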